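import Mathlib
import HarnessLib
import Summits.CriticalPhenomena.CardyFormulaZ2.Theorems.CardyComplexConeEdgeCoherenceLeeYangClassDefs
import Summits.CriticalPhenomena.CardyFormulaZ2.Theorems.CardyComplexConeEdgeCoherenceMedialExplorationRotData

/-!
# Tilted class balance as TILTED ROTATIONAL FORGETTING (sub-goal `classBalance_of_tiltedRotForgetting`)
(line `Sketch`, composition `LeeYang`, crux `EdgeCoherence`, item stmt-CriticalPhenomena-11385)

Route `CardyComplexCone` (sub-problem `CriticalPhenomena/CardyFormulaZ2`), crux
`Summit.CriticalPhenomena.CardyFormulaZ2.Theses.CardyComplexCone.EdgeCoherence`. Helper file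
`--supports stmt-CriticalPhenomena-11385` of the lead's rotational reformulation of the open bet
`Sig.stub_classBalance` (module `…LeeYangClassDefs`: for real fugacities `x` near `1` the four `x`-tilted class
masses `N_c^{(x)}(v) = classGF (Λ δ) δ v c x` agree to `o(Z_v(x))`), built on the exact `ℤ₄` covariance of the
exploration path (`Rotation.medialExploration_rotData`, module `…MedialExplorationRotData`):

* `classGF_rotData_rotAbout` — **exact quarter-turn covariance of the class generating functions**: for ALL
  data (no admissibility), every mesh and every fugacity,
  `classGF (rotData E v) δ (rotAbout v w) (c + 1) ζ = classGF E δ w c ζ` — turning the Dobrushin data about the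
  lattice point `v` carries the class-`c` darts at `w` onto the class-`(c+1)` darts at `rotAbout v w` with the
  SAME winding index (the proof of `Rotation.cornerObs_rotData_faceAt` verbatim, with the integrand `ζ^{m}` in
  place of `exp(−(i/3)W)`); at the centre, `classGF_rotData_self`;
* `indexGF_rotData_rotAbout`, `indexGF_rotData_self` — **the total generating function is INVARIANT**:
  `indexGF (rotData E v) δ (rotAbout v w) ζ = indexGF E δ w ζ` (same transport, the `Fin 4` sum re-indexed by
  `c ↦ c + 1`);
* `Sig.stub_tiltedRotForgetting` — **TILTED ROTATIONAL FORGETTING** (OPEN, nothing asserted — the `LeeYang` bet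
  in forgetting form): the `x`-tilted class masses at `v` forget a quarter turn of the far-away boundary data
  about `v`, to `o(Z_v(x))`, for real fugacities near `1`, eventually in `δ`, uniformly over `v` on compacts;
* `classBalance_of_tiltedRotForgetting : Sig.stub_tiltedRotForgetting → Sig.stub_classBalance` (registered
  sub-goal; by the covariance, forgetting at class `c + 1` IS the agreement of the consecutive classes `c`,
  `c + 1`, and any two classes on the `4`-cycle are at most two consecutive steps apart:
  `norm_sub_le_of_consecutive`), the converse `tiltedRotForgetting_of_classBalance` and the equivalence
  `tiltedRotForgetting_iff_classBalance`.

This is the positive-mass (real-fugacity) twin of the lead's `RotationalForgetting ↔ HarmonicVanishing` for the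
complex corner observable (module `…EdgeCoherenceRotationalForgetting`).

References: H. Duminil-Copin, S. Smirnov, *Conformal invariance of lattice models*, Clay Math. Proc. 15 (2012)
§8 (Conj. 8.7); S. Smirnov, Ann. of Math. 172 (2010) §2.2 (winding = total turning); G. Grimmett,
*Percolation*, 2nd ed. (1999), §1.6 (lattice symmetries of `P_p`). Everything except the `def … : Prop` is proved
inline.
-/

noncomputable section

namespace Summit.CriticalPhenomena.CardyFormulaZ2.Cruxes.EdgeCoherence.LeeYang

open scoped BigOperators Topology
open Filter Set MeasureTheory
open Literature.Probability.LatticeModels Literature.Probability.RandomPlanarGeometry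
open Literature.Probability.Percolation (BondConfig bondPercolation half sym2Equiv)
open Summit.CriticalPhenomena.CardyFormulaZ2.Cruxes.EdgeCoherence.Rotation
open Summit.CriticalPhenomena.CardyFormulaZ2.Cruxes.EdgePrecompact.QkzStripBoundaryArm
  (option_map_eq_some_apply_iff)

/-! ### Exact covariance of the class generating functions -/

/-- **Exact quarter-turn covariance of the class generating function about a lattice point**: the class-`c`
generating function at `w` of the data `E` is the class-`(c+1)` generating function at `rotAbout v w` of the
turned data `rotData E v`, for ALL data, meshes and fugacities (no admissibility). Measure step: `P_{1/2}` is
invariant under `rotAbout v` (`bondPercolation_map_relabel_rotAbout`, `integral_map_equiv`); pointwise step: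
`medialExploration_rotData` and the rigid transport of the integrand (`cornerSource_faceAt_rotAbout`,
`cornerTarget_faceAt_rotAbout`, `winding_take_map_rotAbout`). -/
theorem classGF_rotData_rotAbout (E : DiscreteDobrushin) (δ : ℝ) (v w : Site 2) (c : Fin 4) (ζ : ℂ) :
    classGF (rotData E v) δ (rotAbout v w) (c + 1) ζ = classGF E δ w c ζ := by
  -- adapted from `Rotation.cornerObs_rotData_faceAt`
  unfold classGF
  conv_lhs => rw [← bondPercolation_map_relabel_rotAbout v half]
  rw [integral_map_equiv]
  refine integral_congr_ae (Eventually.of_forall fun ω => ?_)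
  simp only []
  rw [medialExploration_rotData E v ω]
  simp only [List.length_map, List.getElem?_map, cornerSource_faceAt_rotAbout,
    cornerTarget_faceAt_rotAbout, option_map_eq_some_apply_iff (sym2Equiv (rotAbout v)).injective,
    winding_take_map_rotAbout]

/-- **At the centre of the turn**: the class-`(c+1)` generating function at `v` of the turned data IS the
class-`c` generating function at `v` of the data (`classGF_rotData_rotAbout` at `w = v`, `rotAbout_self`). -/
theorem classGF_rotData_self (E : DiscreteDobrushin) (δ : ℝ) (v : Site 2) (c : Fin 4) (ζ : ℂ) :
    classGF (rotData E v) δ v (c + 1) ζ = classGF E δ v c ζ := by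
  simpa only [rotAbout_self] using classGF_rotData_rotAbout E δ v v c ζ

/-- Tilted forgetting at `(δ, v, x)`, read through the covariance: it compares CONSECUTIVE classes of the data,
`classGF (rotData E v) δ v (c+1) ζ − classGF E δ v (c+1) ζ = N_c(ζ) − N_{c+1}(ζ)`. -/
theorem classGF_rot_sub_eq_consecutive (E : DiscreteDobrushin) (δ : ℝ) (v : Site 2) (c : Fin 4) (ζ : ℂ) :
    classGF (rotData E v) δ v (c + 1) ζ - classGF E δ v (c + 1) ζ =
      classGF E δ v c ζ - classGF E δ v (c + 1) ζ := by
  rw [classGF_rotData_self]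

/-- **The total generating function is covariant**: `indexGF (rotData E v) δ (rotAbout v w) ζ = indexGF E δ w ζ`
for ALL data (same transport as `classGF_rotData_rotAbout`, the sum over the four classes re-indexed by
`c ↦ c + 1`). -/
theorem indexGF_rotData_rotAbout (E : DiscreteDobrushin) (δ : ℝ) (v w : Site 2) (ζ : ℂ) :
    indexGF (rotData E v) δ (rotAbout v w) ζ = indexGF E δ w ζ := by
  -- adapted from `Rotation.cornerObs_rotData_faceAt`
  unfold indexGF
  conv_lhs => rw [← bondPercolation_map_relabel_rotAbout v half]
  rw [integral_map_equiv]
  refine integral_congr_ae (Eventually.of_forall fun ω => ?_)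
  simp only []
  rw [medialExploration_rotData E v ω]
  symm
  refine Fintype.sum_equiv (Equiv.addRight 1) _ _ fun c => ?_
  simp only [Equiv.coe_addRight, List.length_map, List.getElem?_map, cornerSource_faceAt_rotAbout,
    cornerTarget_faceAt_rotAbout, option_map_eq_some_apply_iff (sym2Equiv (rotAbout v)).injective,
    winding_take_map_rotAbout]

/-- **The total generating function at the centre is INVARIANT under the turn of the data**:
`indexGF (rotData E v) δ v ζ = indexGF E δ v ζ` (`indexGF_rotData_rotAbout` at `w = v`, `rotAbout_self`). -/
theorem indexGF_rotData_self (E : DiscreteDobrushin) (δ : ℝ) (v : Site 2) (ζ : ℂ) :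
    indexGF (rotData E v) δ v ζ = indexGF E δ v ζ := by
  simpa only [rotAbout_self] using indexGF_rotData_rotAbout E δ v v ζ

/-! ### The statement (nothing asserted) -/

/-- STUB statement — **TILTED ROTATIONAL FORGETTING** (OPEN, nothing asserted — the `LeeYang` bet in
forgetting form): the `x`-tilted class masses at `v` forget a quarter turn of the far-away boundary data about
`v`, to `o(Z_v(x))`, for real fugacities near `1`, eventually in `δ`, uniformly over `v` on compacts. Same
quantifier prefix as `Sig.stub_classBalance`; only the final inequality differs
(`tiltedRotForgetting_iff_classBalance`). -/
def Sig.stub_tiltedRotForgetting : Prop :=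
  ∃ η > (0:ℝ), ∀ (D : DobrushinDomain) (Λ : ℝ → DiscreteDobrushin), (∀ δ, (Λ δ).Ω = D.carrier) →
    (∀ δ, (Λ δ).δ = δ) → (∀ᶠ δ in 𝓝[>] (0:ℝ), (Λ δ).IsZdAdmissible) →
    ∀ K : Set ℂ, IsCompact K → K ⊆ D.carrier → ∀ ε > (0:ℝ), ∀ᶠ δ in 𝓝[>] (0:ℝ),
      ∀ v : Site 2, meshPoint δ v ∈ K → ∀ x : ℝ, |x - 1| < η → ∀ c : Fin 4,
        ‖classGF (rotData (Λ δ) v) δ v c x - classGF (Λ δ) δ v c x‖ ≤ ε * ‖indexGF (Λ δ) δ v x‖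

/-! ### Distances on the `4`-cycle -/

/-- **Consecutive agreement gives pairwise agreement on the `4`-cycle**: if `‖F c − F (c+1)‖ ≤ η` for every
`c : Fin 4`, then `‖F c − F c'‖ ≤ 2η` for all `c, c'` (any two classes are at most two consecutive steps apart
in one of the two directions). -/
theorem norm_sub_le_of_consecutive (F : Fin 4 → ℂ) {η : ℝ} (h : ∀ c : Fin 4, ‖F c - F (c + 1)‖ ≤ η)
    (c c' : Fin 4) : ‖F c - F c'‖ ≤ 2 * η := by
  have hη : 0 ≤ η := (norm_nonneg _).trans (h 0)
  -- no step, one step forward, two steps forward, one step back (= three steps forward)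
  have h0 : ∀ c : Fin 4, ‖F c - F (c + 0)‖ ≤ 2 * η := fun c => by
    rw [add_zero, sub_self, norm_zero]
    positivity
  have h1 : ∀ c : Fin 4, ‖F c - F (c + 1)‖ ≤ 2 * η := fun c => (h c).trans (by linarith)
  have h2 : ∀ c : Fin 4, ‖F c - F (c + 2)‖ ≤ 2 * η := fun c => by
    have e : c + 2 = c + 1 + 1 := by
      have : ∀ c : Fin 4, c + 2 = c + 1 + 1 := by decide
      exact this c
    calc ‖F c - F (c + 2)‖ = ‖(F c - F (c + 1)) + (F (c + 1) - F (c + 1 + 1))‖ := by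
          rw [sub_add_sub_cancel, ← e]
      _ ≤ ‖F c - F (c + 1)‖ + ‖F (c + 1) - F (c + 1 + 1)‖ := norm_add_le _ _
      _ ≤ η + η := add_le_add (h c) (h (c + 1))
      _ = 2 * η := by ring
  have h3 : ∀ c : Fin 4, ‖F c - F (c + 3)‖ ≤ 2 * η := fun c => by
    have e : c + 3 + 1 = c := by
      have : ∀ c : Fin 4, c + 3 + 1 = c := by decide
      exact this c
    have := h1 (c + 3)
    rw [e, norm_sub_rev] at this
    exact this
  obtain ⟨j, rfl⟩ : ∃ j : Fin 4, c' = c + j := ⟨c' - c, by abel⟩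
  fin_cases j
  exacts [h0 c, h1 c, h2 c, h3 c]

/-! ### The registered sub-goal and its converse -/

/-- **Sub-goal `classBalance_of_tiltedRotForgetting`** (registered sub-goal of line `Sketch`, composition
`LeeYang`): TILTED ROTATIONAL FORGETTING ⇒ TILTED CLASS BALANCE, with the same `η`. Given `ε`, run forgetting
with `ε/2`; at `(δ, v, x)` the covariance `classGF_rotData_self` turns forgetting at class `c + 1` into
`‖N_c − N_{c+1}‖ ≤ (ε/2) ‖Z‖`, and `norm_sub_le_of_consecutive` gives `‖N_c − N_{c'}‖ ≤ ε ‖Z‖`. -/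
theorem classBalance_of_tiltedRotForgetting : Sig.stub_tiltedRotForgetting → Sig.stub_classBalance := by
  rintro ⟨η, hη, h⟩
  refine ⟨η, hη, fun D Λ hΩ hδ hadm K hK hKD ε hε => ?_⟩
  filter_upwards [h D Λ hΩ hδ hadm K hK hKD (ε / 2) (by positivity)] with δ hforget v hv x hx c c'
  have hcons : ∀ c : Fin 4, ‖classGF (Λ δ) δ v c x - classGF (Λ δ) δ v (c + 1) x‖ ≤
      ε / 2 * ‖indexGF (Λ δ) δ v x‖ := fun c => by
    rw [← classGF_rot_sub_eq_consecutive]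
    exact hforget v hv x hx (c + 1)
  have := norm_sub_le_of_consecutive (fun c => classGF (Λ δ) δ v c x) hcons c c'
  linarith

/-- **The converse**: TILTED CLASS BALANCE ⇒ TILTED ROTATIONAL FORGETTING, with the same `η` and `ε`
(forgetting at class `c = (c−1)+1` is the agreement of the classes `c − 1`, `c`, by `classGF_rotData_self`). -/
theorem tiltedRotForgetting_of_classBalance : Sig.stub_classBalance → Sig.stub_tiltedRotForgetting := by
  rintro ⟨η, hη, h⟩
  refine ⟨η, hη, fun D Λ hΩ hδ hadm K hK hKD ε hε => ?_⟩
  filter_upwards [h D Λ hΩ hδ hadm K hK hKD ε hε] with δ hbal v hv x hx c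
  have hc : c = (c - 1) + 1 := (sub_add_cancel c 1).symm
  rw [hc, classGF_rot_sub_eq_consecutive]
  exact hbal v hv x hx (c - 1) (c - 1 + 1)

/-- **TILTED ROTATIONAL FORGETTING ↔ TILTED CLASS BALANCE**: the `x`-tilted class masses at `v` forget a
quarter turn of the far boundary data about `v` (to `o(Z_v(x))`) iff the four of them agree to `o(Z_v(x))`. -/
theorem tiltedRotForgetting_iff_classBalance : Sig.stub_tiltedRotForgetting ↔ Sig.stub_classBalance :=
  ⟨classBalance_of_tiltedRotForgetting, tiltedRotForgetting_of_classBalance⟩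

end Summit.CriticalPhenomena.CardyFormulaZ2.Cruxes.EdgeCoherence.LeeYang

end
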